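import Literature.NumberTheory.EllipticCurves.IwasawaSelmerQuadraticLayerDecomposition
import Literature.NumberTheory.EllipticCurves.FineSelmerDevissageProofs
import Literature.NumberTheory.EllipticCurves.FineSelmerCoefficientMapProofs
import Literature.NumberTheory.EllipticCurves.SubgroupSelmerCocycleCriteriaProofs
import Literature.NumberTheory.EllipticCurves.SelmerRestrictionCorankRelative
import Literature.NumberTheory.GaloisRepresentations.ContinuousH1OrderTwo
import Literature.NumberTheory.GaloisRepresentations.AbsIntegersEquiv
import HarnessLib

/-!
# The `±`-decomposition of the FINE Selmer group along the quadratic layer `K_∞(√d)/K_∞` of a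
# `ℤ_p`-tower, inside `Γ_K`: `Sel₀(E/K_∞) × Sel₀(E^{(d)}/K_∞) → {classes on Gal(K̄/K_∞(√d)) locally trivial at every prime}`
# has kernel killed by `4` and `4 ·` the target in its image (THEOREMS only; no definition, no named fact)

The fine (everywhere locally trivial) companion of `IwasawaSelmerQuadraticLayerDecomposition` (t42 GEN 23, the ordinary
Selmer group): the SAME engine `IndexTwoDecompositionData` (`H1CorestrictionIndexTwo`; Dokchitser–Dokchitser 2010
Lemma 4.14 mechanism: restriction/corestriction along the index-`2` subgroup `kerStab κ θ = Gal(K̄/K_∞(θ))` of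
`ker κ = Gal(K̄/K_∞)`, `θ² = d`), run with

* `S = Sel₀(K_∞, E[p^∞])`, `S′ = Sel₀(K_∞, E₂[p^∞])` (`E₂` a `K`-model of `E^{(d)}`; tree `fineSelmerInfty`), and
* `T` = the classes in `H¹(Gal(K̄/K_∞(θ)), E[p^∞])` that are **locally trivial at every prime**, i.e. restrict to zero
  on `kerStab κ θ ⊓ D_𝔓` for EVERY maximal ideal `𝔓` of `\bar ℤ_K` (`D_𝔓` its decomposition group) — the
  `Γ_K`-intrinsic form of «the fine Selmer group of `E` over `K_∞(θ)` away from the archimedean places» (the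
  identification with the genuine `Sel₀(E/K(θ)·K_∞)` over the field `K(θ)` is a separate file).

§1 The prime-wise form of the fine local conditions (any `H ≤ Γ_K` normal, any discrete `M`): «restricts to zero on
`H ⊓ D_𝔓` for all maximal `𝔓`» is stable under `conj_τ` (`D_{τ⁻¹𝔓} = τ⁻¹ D_𝔓 τ`), under restriction to a smaller `H`,
implies the tree's chosen-place conditions `conj_σ c ∈ awayKer` (`D_v = D_{𝔓₀(v)}`), and holds for every class of
`Sel₀(K_∞, M)` (tree `FineSelmerDevissage.exists_eq_smul_sub_of_mem_fineSelmerInfty`); conversely it gives membership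
in `Sel₀(K_∞, M)` together with the archimedean conditions.
§2 The index-`2` step: if `res_{N} η` (`N ≤ G` of index `2`, copy open) is locally trivial at every prime then
`2 · res_{G ⊓ D_𝔓} η = 0` (`cor ∘ res`, tree `index_nsmul_eq_zero_of_resSubgroupH1_eq_zero` on the OPEN subgroup
`(N ⊓ D_𝔓) ≤ (G ⊓ D_𝔓)` of index `∣ 2`); at an archimedean place `2 · H¹(G ⊓ D_w, M) = 0` outright (`|D_w| ≤ 2`);
hence `2 η ∈ Sel₀(K_∞, M)`.
§3 The twist `Ψ` (`QuadraticLayer.twistResEquiv`) preserves prime-wise local triviality.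
§4 **`four_nsmul_eq_zero_of_fineRes_add_twistFineRes_eq_zero`**, **`exists_fineRes_add_twistFineRes_eq_four_nsmul`**,
and the landing lemmas `forall_prime_resOfLe_eq_zero_of_mem_fineSelmerInfty(_twist)`.

Everything is proved (no named fact, no instance, no `sorry`). Motivation (cell `bsd-2adic`, seat `conv-1` GEN 32, crux
stmt-BirchSwinnertonDyer-19556, the memo binder (S) `LambdaShapiroFineAtTwo` of stub 4‴): `K = ℚ`, `p = 2`, `d = d_F` for an
imaginary quadratic `F`; the dual statement `λ(X₀(E/F_∞)) = λ(X₀(E/ℚ_∞)) + λ(X₀(E^{(d_F)}/ℚ_∞))` is assembled elsewhere.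

## References

* [GreenbergLNM1716] R. Greenberg, LNM 1716 (1999), §1 (p. 60), §2, §4 (p. 107).
* [DokchitserDokchitserAnnals2010] T. Dokchitser, V. Dokchitser, Ann. of Math. 172 (2010), Lemma 4.14 (proof).
* [CoatesSujatha2005] J. Coates, R. Sujatha, Math. Ann. 331 (2005), §3 (the fine Selmer group: locally trivial everywhere).
* [SerreGaloisCohomology1997] J.-P. Serre, *Galois Cohomology*, I.§2.4 (Prop. 9: `(G:N)` kills `ker res`), I.§2.5.
* [NeukirchANT1999] J. Neukirch, *Algebraic Number Theory*, Ch. I §9 ((9.1), (9.5)).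
-/

set_option autoImplicit false

noncomputable section

open scoped Classical Pointwise

namespace Literature.NumberTheory.EllipticCurves

namespace FineQuadraticLayer

open NumberField IsDedekindDomain Field _root_.WeierstrassCurve
open Literature.NumberTheory.EllipticCurves.QuadraticTwistSelmer Literature.NumberTheory.EllipticCurves.CoeffTwist
open Literature.NumberTheory.EllipticCurves.GreenbergSelmer Literature.NumberTheory.GaloisRepresentations
  Literature.NumberTheory.EllipticCurves.FineSelmerDevissage
  Literature.NumberTheory.EllipticCurves.FineSelmerTrivialisingRestriction
  Literature.NumberTheory.EllipticCurves.FineSelmerCoefficientMap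
  Literature.NumberTheory.EllipticCurves.CocycleCriteria
  Literature.NumberTheory.EllipticCurves.QuadraticLayer

/-! ## §1 Prime-wise local triviality -/

section Primewise

variable {K : Type} [Field K] [NumberField K]
variable {M : Type} [AddCommGroup M] [DistribMulAction (absoluteGaloisGroup K) M]
  [TopologicalSpace M] [DiscreteTopology M]

/-- A `Γ_K`-conjugate of a maximal ideal of `\bar ℤ_K` is maximal. [cite: NeukirchANT1999, Ch. I §9 Prop. (9.1)] -/
theorem isMaximal_smul (𝔓 : Ideal (absIntegers (𝓞 K) K)) [𝔓.IsMaximal] (g : absoluteGaloisGroup K) :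
    (g • 𝔓).IsMaximal := by
  obtain ⟨v, hv⟩ := FineSelmerTrivialisingRestriction.exists_mem_primesAbove_of_isMaximal 𝔓
  exact HeightOneSpectrum.isMaximal_of_mem_primesAbove (smul_mem_primesAbove hv g)

omit [NumberField K] in
/-- `x ∈ D_𝔓 ⟹ τ⁻¹ x τ ∈ D_{τ⁻¹ • 𝔓}` (`D_{g𝔓} = g D_𝔓 g⁻¹`). [cite: NeukirchANT1999, Ch. I §9 (after (9.5))] -/
theorem conj_mem_decompositionSubgroup_smul (𝔓 : Ideal (absIntegers (𝓞 K) K)) (τ : absoluteGaloisGroup K)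
    {x : absoluteGaloisGroup K} (hx : x ∈ 𝔓.decompositionSubgroup (absoluteGaloisGroup K)) :
    τ⁻¹ * x * τ ∈ (τ⁻¹ • 𝔓).decompositionSubgroup (absoluteGaloisGroup K) := by
  rw [Ideal.decompositionSubgroup_smul, Subgroup.mem_pointwise_smul_iff_inv_smul_mem, map_inv, inv_inv,
    MulAut.smul_def, MulAut.conj_apply]
  have : τ * (τ⁻¹ * x * τ) * τ⁻¹ = x := by group
  rw [this]
  exact hx

variable (H : Subgroup (absoluteGaloisGroup K)) [H.Normal]

/-- **Prime-wise local triviality is stable under `conj_τ`** (`τ ∈ Γ_K`): if `y ∈ H¹(H, M)` restricts to zero on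
`H ⊓ D_𝔓` for every maximal `𝔓`, so does `conj_τ y` — on cocycles, `τ • z(τ⁻¹ x τ) = x • (τ • b) − τ • b` for
`x ∈ D_𝔓` from `z = (· • b − b)` on `H ⊓ D_{τ⁻¹𝔓}`. [cite: SerreGaloisCohomology1997, I.§2.5]
[cite: NeukirchANT1999, Ch. I §9 (after (9.5))] -/
theorem forall_prime_conjH1 (y : subgroupH1 H M)
    (hy : ∀ (𝔓 : Ideal (absIntegers (𝓞 K) K)), 𝔓.IsMaximal →
      resOfLe M (inf_le_left : H ⊓ 𝔓.decompositionSubgroup (absoluteGaloisGroup K) ≤ H) y = 0)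
    (τ : absoluteGaloisGroup K) (𝔓 : Ideal (absIntegers (𝓞 K) K)) [𝔓.IsMaximal] :
    resOfLe M (inf_le_left : H ⊓ 𝔓.decompositionSubgroup (absoluteGaloisGroup K) ≤ H) (conjH1 H M τ y) = 0 := by
  obtain ⟨z, rfl⟩ := oneCocycleClass_surjective _ y
  haveI := isMaximal_smul 𝔓 τ⁻¹
  obtain ⟨b, hb⟩ := (CocycleCriteria.resOfLe_oneCocycleClass_eq_zero_iff
    (inf_le_left : H ⊓ (τ⁻¹ • 𝔓).decompositionSubgroup (absoluteGaloisGroup K) ≤ H) z).1 (hy _ inferInstance)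
  refine (CocycleCriteria.conjH1_oneCocycleClass_mem_ker_resOfLe_iff _ τ z).2 ⟨τ • b, fun x ↦ ?_⟩
  obtain ⟨hxH, hxD⟩ := Subgroup.mem_inf.1 x.2
  have hxH' : τ⁻¹ * (x : absoluteGaloisGroup K) * τ ∈ H := by
    simpa only [inv_inv] using (inferInstance : H.Normal).conj_mem _ hxH τ⁻¹
  have h := hb ⟨τ⁻¹ * (x : absoluteGaloisGroup K) * τ,
    Subgroup.mem_inf.2 ⟨hxH', conj_mem_decompositionSubgroup_smul 𝔓 τ hxD⟩⟩
  have hconj : subgroupConj H τ (Subgroup.inclusion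
      (inf_le_left : H ⊓ 𝔓.decompositionSubgroup (absoluteGaloisGroup K) ≤ H) x) =
      Subgroup.inclusion (inf_le_left : H ⊓ (τ⁻¹ • 𝔓).decompositionSubgroup (absoluteGaloisGroup K) ≤ H)
        ⟨τ⁻¹ * (x : absoluteGaloisGroup K) * τ,
          Subgroup.mem_inf.2 ⟨hxH', conj_mem_decompositionSubgroup_smul 𝔓 τ hxD⟩⟩ :=
    Subtype.ext (by simp only [subgroupConj_apply_coe, Subgroup.coe_inclusion])
  rw [hconj, h]
  change τ • ((τ⁻¹ * (x : absoluteGaloisGroup K) * τ) • b - b) = (x : absoluteGaloisGroup K) • (τ • b) - τ • b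
  rw [smul_sub, smul_smul, ← mul_assoc, ← mul_assoc, mul_inv_cancel, one_mul, mul_smul]

omit [NumberField K] [H.Normal] in
/-- **Prime-wise local triviality descends along restriction** to a smaller subgroup `H ≤ H′`.
[cite: SerreGaloisCohomology1997, I.§2.5] -/
theorem forall_prime_resOfLe {H' : Subgroup (absoluteGaloisGroup K)} (hle : H ≤ H') (y : subgroupH1 H' M)
    (hy : ∀ (𝔓 : Ideal (absIntegers (𝓞 K) K)), 𝔓.IsMaximal →
      resOfLe M (inf_le_left : H' ⊓ 𝔓.decompositionSubgroup (absoluteGaloisGroup K) ≤ H') y = 0)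
    (𝔓 : Ideal (absIntegers (𝓞 K) K)) [𝔓.IsMaximal] :
    resOfLe M (inf_le_left : H ⊓ 𝔓.decompositionSubgroup (absoluteGaloisGroup K) ≤ H) (resOfLe M hle y) = 0 := by
  have hle' : H ⊓ 𝔓.decompositionSubgroup (absoluteGaloisGroup K) ≤ H' ⊓ 𝔓.decompositionSubgroup (absoluteGaloisGroup K) :=
    inf_le_inf_right _ hle
  have h1 : resOfLe M (inf_le_left : H ⊓ 𝔓.decompositionSubgroup (absoluteGaloisGroup K) ≤ H) (resOfLe M hle y) =
      resOfLe M hle' (resOfLe M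
        (inf_le_left : H' ⊓ 𝔓.decompositionSubgroup (absoluteGaloisGroup K) ≤ H') y) := by
    rw [← AddMonoidHom.comp_apply, ← AddMonoidHom.comp_apply, resOfLe_comp_holds, resOfLe_comp_holds]
  rw [h1, hy 𝔓 inferInstance, map_zero]

/-- **Prime-wise local triviality gives the tree's chosen-place conditions with all conjugates**: if `y` restricts to
zero on `H ⊓ D_𝔓` for every maximal `𝔓`, then `conj_σ y` restricts to zero on `H ⊓ D_v` (`D_v = D_{𝔓₀(v)}`, tree
`decompositionSubgroup_adicCompletionPrime_eq_range`) for every finite place `v` and every `σ ∈ Γ_K`.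
[cite: NeukirchANT1999, Ch. II §9 Prop. (9.6)] [cite: SerreGaloisCohomology1997, I.§2.5] -/
theorem resOfLe_decomp_conjH1_eq_zero_of_forall_prime (y : subgroupH1 H M)
    (hy : ∀ (𝔓 : Ideal (absIntegers (𝓞 K) K)), 𝔓.IsMaximal →
      resOfLe M (inf_le_left : H ⊓ 𝔓.decompositionSubgroup (absoluteGaloisGroup K) ≤ H) y = 0)
    (v : HeightOneSpectrum (𝓞 K)) (σ : absoluteGaloisGroup K) :
    resOfLe M (inf_le_left : H ⊓ decomp v ≤ H) (conjH1 H M σ y) = 0 := by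
  haveI := adicCompletionPrime_isMaximal K v
  have h := forall_prime_conjH1 H y hy σ (adicCompletionPrime K v)
  have hD : (adicCompletionPrime K v).decompositionSubgroup (absoluteGaloisGroup K) = decomp v :=
    decompositionSubgroup_adicCompletionPrime_eq_range K v
  -- transport along the equality of subgroups `D_{𝔓₀(v)} = D_v`
  have key : ∀ {A B : Subgroup (absoluteGaloisGroup K)} (_ : A = B) (hA : H ⊓ A ≤ H) (hB : H ⊓ B ≤ H)
      (x : subgroupH1 H M), resOfLe M hA x = 0 → resOfLe M hB x = 0 := by
    intro A B e; subst e; intro hA hB x hx; exact hx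
  exact key hD _ _ _ h

variable {p : ℕ} [Fact p.Prime] (κ : ZpExtension K p)

/-- **Every class of `Sel₀(K_∞, M)` is locally trivial at every prime**: it restricts to zero on `Gal(K̄/K_∞) ⊓ D_𝔓`
for every maximal ideal `𝔓` of `\bar ℤ_K` (the class-level form of the tree's
`FineSelmerDevissage.exists_eq_smul_sub_of_mem_fineSelmerInfty`). [cite: CoatesSujatha2005, §3 (R(E/F_∞): locally trivial everywhere)] -/
theorem forall_prime_of_mem_fineSelmerInfty {c : subgroupH1 κ.kerSubgroup M} (hc : c ∈ fineSelmerInfty M κ)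
    (𝔓 : Ideal (absIntegers (𝓞 K) K)) [𝔓.IsMaximal] :
    resOfLe M (inf_le_left : κ.kerSubgroup ⊓ 𝔓.decompositionSubgroup (absoluteGaloisGroup K) ≤ κ.kerSubgroup) c = 0 := by
  obtain ⟨z, rfl⟩ := oneCocycleClass_surjective _ c
  obtain ⟨a, ha⟩ := exists_eq_smul_sub_of_mem_fineSelmerInfty κ z hc 𝔓
  exact (CocycleCriteria.resOfLe_oneCocycleClass_eq_zero_iff _ z).2 ⟨a, fun x ↦ ha ⟨x, (Subgroup.mem_inf.1 x.2).1⟩ (Subgroup.mem_inf.1 x.2).2⟩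

/-- **Membership in `Sel₀(K_∞, M)` from prime-wise local triviality** plus the archimedean conditions
(tree `mem_fineSelmerInfty_iff_resOfLe`). [cite: CoatesSujatha2005, §3] [cite: Greenberg1989, §1 p. 98] -/
theorem mem_fineSelmerInfty_of_forall_prime (c : subgroupH1 κ.kerSubgroup M)
    (hc : ∀ (𝔓 : Ideal (absIntegers (𝓞 K) K)), 𝔓.IsMaximal →
      resOfLe M (inf_le_left : κ.kerSubgroup ⊓ 𝔓.decompositionSubgroup (absoluteGaloisGroup K) ≤ κ.kerSubgroup) c = 0)
    (hinf : ∀ (w : InfinitePlace K) (σ : absoluteGaloisGroup K),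
      resOfLe M (inf_le_left : κ.kerSubgroup ⊓ decompInf w ≤ κ.kerSubgroup) (conjH1 κ.kerSubgroup M σ c) = 0) :
    c ∈ fineSelmerInfty M κ :=
  (mem_fineSelmerInfty_iff_resOfLe κ c).2
    ⟨fun v σ ↦ resOfLe_decomp_conjH1_eq_zero_of_forall_prime κ.kerSubgroup c hc v σ, hinf⟩

end Primewise

/-! ## §2 The index-`2` step and the archimedean places -/

section IndexTwo

variable {K : Type} [Field K] [NumberField K]
variable {M : Type} [AddCommGroup M] [DistribMulAction (absoluteGaloisGroup K) M]
  [TopologicalSpace M] [DiscreteTopology M]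

omit [NumberField K] in
/-- **`2 · H¹(G ⊓ D_w, M) = 0` at an archimedean place `w`**: `G ⊓ D_w` embeds into `Γ_{K_w}`, of order `≤ 2`, and
`H¹` of a group of order `≤ 2` is killed by `2` (tree `two_nsmul_continuousCohomology_one_eq_zero_of_natCard_le_two`).
[cite: SerreGaloisCohomology1997, I.§2.4] -/
theorem two_nsmul_subgroupH1_inf_decompInf_eq_zero (G : Subgroup (absoluteGaloisGroup K)) (w : InfinitePlace K)
    (ξ : subgroupH1 (G ⊓ decompInf w) M) : 2 • ξ = 0 := by
  haveI := finite_absoluteGaloisGroup_completion_infinitePlace w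
  have hsurj : ∀ g : (G ⊓ decompInf w : Subgroup (absoluteGaloisGroup K)),
      ∃ τ : absoluteGaloisGroup w.Completion, absGaloisRestrict K w.Completion τ = g := fun g ↦
    (Subgroup.mem_inf.mp g.2).2
  choose lift hlift using hsurj
  have hinj : Function.Injective lift := fun g g' h ↦ by
    apply Subtype.ext
    rw [← hlift g, ← hlift g', h]
  haveI : Finite (G ⊓ decompInf w : Subgroup (absoluteGaloisGroup K)) := Finite.of_injective lift hinj
  have hcard : Nat.card (G ⊓ decompInf w : Subgroup (absoluteGaloisGroup K)) ≤ 2 :=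
    (Nat.card_le_card_of_injective lift hinj).trans (natCard_absoluteGaloisGroup_completion_infinitePlace_le_two w)
  exact two_nsmul_continuousCohomology_one_eq_zero_of_natCard_le_two hcard _ ξ

variable {G N : Subgroup (absoluteGaloisGroup K)} [N.Normal] (hNG : N ≤ G)
  (hopen : IsOpen ((N.subgroupOf G : Subgroup G) : Set G)) (hidx : N.relIndex G ∣ 2)

omit [NumberField K] in
include hopen hidx in
/-- **The index-`2` step.** If `N ≤ G` (`N` normal in `Γ_K`, its copy OPEN in `G`, `[G : N] ∣ 2`) and `res_N η` restricts
to zero on `N ⊓ D_𝔓` for every maximal `𝔓`, then `2 · res_{G ⊓ D_𝔓} η = 0` for every maximal `𝔓`: `cor ∘ res = [G ⊓ D_𝔓 :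
N ⊓ D_𝔓]` on `H¹(G ⊓ D_𝔓, M)` (tree `index_nsmul_eq_zero_of_resSubgroupH1_eq_zero`), and this index divides `[G : N]`.
[cite: SerreGaloisCohomology1997, I.§2.4 (Prop. 9)] [cite: DokchitserDokchitserAnnals2010, Lemma 4.14 (proof)] -/
theorem two_nsmul_resOfLe_decompositionSubgroup_eq_zero (η : subgroupH1 G M)
    (hη : ∀ (𝔓 : Ideal (absIntegers (𝓞 K) K)), 𝔓.IsMaximal →
      resOfLe M (inf_le_left : N ⊓ 𝔓.decompositionSubgroup (absoluteGaloisGroup K) ≤ N) (resOfLe M hNG η) = 0)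
    (𝔓 : Ideal (absIntegers (𝓞 K) K)) [𝔓.IsMaximal] :
    2 • resOfLe M (inf_le_left : G ⊓ 𝔓.decompositionSubgroup (absoluteGaloisGroup K) ≤ G) η = 0 := by
  set D := 𝔓.decompositionSubgroup (absoluteGaloisGroup K) with hD
  set GD : Subgroup (absoluteGaloisGroup K) := G ⊓ D with hGD
  have hA : N ⊓ D ≤ GD := inf_le_inf_right D hNG
  set ξ := resOfLe M (inf_le_left : GD ≤ G) η with hξ
  -- `res_{N ⊓ D} ξ = 0`
  have h0 : resSubgroupH1 ((N ⊓ D).subgroupOf GD) M ξ = 0 := by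
    rw [resSubgroupH1_subgroupOf_eq M hA ξ, hξ, ← AddMonoidHom.comp_apply (resOfLe M hA), resOfLe_comp_holds]
    have h1 : resOfLe M (hA.trans (inf_le_left : GD ≤ G)) η =
        resOfLe M (inf_le_left : N ⊓ D ≤ N) (resOfLe M hNG η) := by
      rw [← AddMonoidHom.comp_apply, resOfLe_comp_holds]
    rw [h1, hη 𝔓 inferInstance, map_zero]
  -- the copy of `N ⊓ D` in `G ⊓ D` is open
  have hopen' : IsOpen (((N ⊓ D).subgroupOf GD : Subgroup GD) : Set GD) := by
    have hset : (((N ⊓ D).subgroupOf GD : Subgroup GD) : Set GD) =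
        Subgroup.inclusion (inf_le_left : GD ≤ G) ⁻¹' ((N.subgroupOf G : Subgroup G) : Set G) := by
      ext x
      simp only [SetLike.mem_coe, Subgroup.mem_subgroupOf, Subgroup.mem_inf, Set.mem_preimage, Subgroup.coe_inclusion]
      exact ⟨fun h ↦ h.1, fun h ↦ ⟨h, (Subgroup.mem_inf.1 x.2).2⟩⟩
    rw [hset]
    exact hopen.preimage (continuous_inclusion (show ((GD : Subgroup (absoluteGaloisGroup K)) :
      Set (absoluteGaloisGroup K)) ⊆ (G : Set (absoluteGaloisGroup K)) from inf_le_left))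
  -- its index divides `2`
  have hidx' : ((N ⊓ D).subgroupOf GD).index ∣ 2 := by
    have heq : (N ⊓ D).subgroupOf GD = N.subgroupOf GD := by
      ext x
      simp only [Subgroup.mem_subgroupOf, Subgroup.mem_inf]
      exact ⟨fun h ↦ h.1, fun h ↦ ⟨h, (Subgroup.mem_inf.1 x.2).2⟩⟩
    rw [heq]
    change N.relIndex GD ∣ 2
    exact (relIndex_dvd_relIndex_of_le (A := N) (B := GD) (inf_le_left : GD ≤ G)).trans hidx
  haveI : ((N ⊓ D).subgroupOf GD).FiniteIndex :=
    ⟨fun h0 ↦ by rw [h0] at hidx'; exact two_ne_zero (zero_dvd_iff.mp hidx')⟩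
  haveI : Fintype (GD ⧸ (N ⊓ D).subgroupOf GD) := Fintype.ofFinite _
  have hkill := index_nsmul_eq_zero_of_resSubgroupH1_eq_zero ((N ⊓ D).subgroupOf GD) hopen' h0
  obtain ⟨m, hm⟩ := hidx'
  rw [hm, mul_comm, ← smul_smul, hkill, smul_zero]

variable {p : ℕ} [Fact p.Prime] (κ : ZpExtension K p)

/-- **`2 η ∈ Sel₀(K_∞, M)` as soon as `res_N η` is locally trivial at every prime**, for `N ≤ Gal(K̄/K_∞)` normal in
`Γ_K` with open copy of index `∣ 2` (the fine analogue of `QuadraticLayer.relIndex_nsmul_mem_selmerGroupOver_of_resOfLe_mem'`;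
the archimedean conditions hold for `2 η` outright). [cite: DokchitserDokchitserAnnals2010, Lemma 4.14 (proof)]
[cite: SerreGaloisCohomology1997, I.§2.4 (Prop. 9)] -/
theorem two_nsmul_mem_fineSelmerInfty_of_forall_prime (hNκ : N ≤ κ.kerSubgroup) (η : subgroupH1 κ.kerSubgroup M)
    (hη : ∀ (𝔓 : Ideal (absIntegers (𝓞 K) K)), 𝔓.IsMaximal →
      resOfLe M (inf_le_left : N ⊓ 𝔓.decompositionSubgroup (absoluteGaloisGroup K) ≤ N) (resOfLe M hNκ η) = 0)
    (hopenκ : IsOpen ((N.subgroupOf κ.kerSubgroup : Subgroup κ.kerSubgroup) : Set κ.kerSubgroup))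
    (hidxκ : N.relIndex κ.kerSubgroup ∣ 2) :
    2 • η ∈ fineSelmerInfty M κ := by
  refine mem_fineSelmerInfty_of_forall_prime κ (2 • η) (fun 𝔓 h𝔓 ↦ ?_) (fun w σ ↦ ?_)
  · rw [map_nsmul]
    exact two_nsmul_resOfLe_decompositionSubgroup_eq_zero hNκ hopenκ hidxκ η hη 𝔓
  · rw [map_nsmul, map_nsmul]
    exact two_nsmul_subgroupH1_inf_decompInf_eq_zero κ.kerSubgroup w _

end IndexTwo

/-! ## §3 The twist `Ψ` preserves prime-wise local triviality -/

section Twist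

variable {K : Type} [Field K] [NumberField K] {p : ℕ} [Fact p.Prime] (κ : ZpExtension K p)
  (W W₂ : WeierstrassCurve K) {d : K} (hd : d ≠ 0) {V : VariableChange K} (hV : V • W₂ = W.quadraticTwist d)
  {θ : AlgebraicClosure K} (hθ : θ ^ 2 = algebraMap K (AlgebraicClosure K) d)

/-- **`res_{H₁} (Ψ x) = 0 ↔ res_{H₁} x = 0`** for `H₁ ≤ kerStab κ θ`: the twist `Ψ = Ψ_e` (`QuadraticLayer.twistResEquiv`, the map
of `H¹` along the `kerStab`-equivariant isomorphism `E₂[p^∞] ≅ E[p^∞]`) commutes with restriction (tree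
`resOfLe_comp_resH1Hom_id`), and on `H¹(H₁, ·)` it is again an isomorphism (`subgroupH1Congr`).
[cite: GreenbergLNM1716, §4 p. 107] [cite: SerreGaloisCohomology1997, I.§2.4] -/
theorem resOfLe_twistResEquiv_eq_zero_iff {H₁ : Subgroup (absoluteGaloisGroup K)} (hle : H₁ ≤ kerStab κ θ)
    (x : W₂.subgroupH1 p (kerStab κ θ)) :
    W.resOfLe p hle (twistResEquiv W W₂ hd hV hθ κ x) = 0 ↔ W₂.resOfLe p hle x = 0 := by
  have hχ₁ : ∀ σ : absoluteGaloisGroup K, σ ∈ H₁ → quadraticSign θ σ = 1 :=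
    fun σ hσ ↦ quadraticSign_of_mem_kerStab κ σ (hle hσ)
  let e := twistEquiv W W₂ hd hV hθ
  let ψ : geomPrimaryTorsion W₂ p →+ geomPrimaryTorsion W p :=
    (primaryComponentCongr e p : geomPrimaryTorsion W₂ p ≃+ geomPrimaryTorsion W p)
  have hψ₂ : ∀ (g : kerStab κ θ) (t : geomPrimaryTorsion W₂ p),
      ψ (ContinuousMonoidHom.id (kerStab κ θ) g • t) = g • ψ t :=
    fun g t ↦ primaryComponentCongr_smul_subgroup p (kerStab κ θ) e (quadraticSign θ) (twistEquiv_smul W W₂ hd hV hθ)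
      (quadraticSign_of_mem_kerStab (θ := θ) κ) g t
  have hψ₁ : ∀ (g : H₁) (t : geomPrimaryTorsion W₂ p), ψ (ContinuousMonoidHom.id H₁ g • t) = g • ψ t :=
    fun g t ↦ primaryComponentCongr_smul_subgroup p H₁ e (quadraticSign θ) (twistEquiv_smul W W₂ hd hV hθ) hχ₁ g t
  have hcomp := resOfLe_comp_resH1Hom_id (M := geomPrimaryTorsion W₂ p) (M' := geomPrimaryTorsion W p) hle ψ hψ₂ hψ₁
  have h1 : W.resOfLe p hle (twistResEquiv W W₂ hd hV hθ κ x) =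
      subgroupH1Congr H₁ (primaryComponentCongr e p) hψ₁ (W₂.resOfLe p hle x) := by
    rw [subgroupH1Congr_apply]
    exact DFunLike.congr_fun hcomp x
  rw [h1, AddEquiv.map_eq_zero_iff]

/-- **`Ψ x` is locally trivial at every prime iff `x` is.** [cite: GreenbergLNM1716, §4 p. 107] -/
theorem forall_prime_twistResEquiv_iff (x : W₂.subgroupH1 p (kerStab κ θ)) :
    (∀ (𝔓 : Ideal (absIntegers (𝓞 K) K)), 𝔓.IsMaximal →
      W.resOfLe p (inf_le_left : kerStab κ θ ⊓ 𝔓.decompositionSubgroup (absoluteGaloisGroup K) ≤ kerStab κ θ)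
        (twistResEquiv W W₂ hd hV hθ κ x) = 0) ↔
    ∀ (𝔓 : Ideal (absIntegers (𝓞 K) K)), 𝔓.IsMaximal →
      W₂.resOfLe p (inf_le_left : kerStab κ θ ⊓ 𝔓.decompositionSubgroup (absoluteGaloisGroup K) ≤ kerStab κ θ) x = 0 :=
  forall₂_congr fun _ _ ↦ resOfLe_twistResEquiv_eq_zero_iff κ W W₂ hd hV hθ _ x

end Twist

/-! ## §4 The `±`-decomposition of the fine Selmer groups over `K_∞` -/

section Data

variable {K : Type} [Field K] [NumberField K] {p : ℕ} [Fact p.Prime] (κ : ZpExtension K p)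
  (W W₂ : WeierstrassCurve K) {d : K} (hd : d ≠ 0) {V : VariableChange K} (hV : V • W₂ = W.quadraticTwist d)
  {θ : AlgebraicClosure K} (hθ : θ ^ 2 = algebraMap K (AlgebraicClosure K) d)
  {c : absoluteGaloisGroup K} (hcκ : c ∈ κ.kerSubgroup) (hcθ : c • θ = -θ)

/-- **A fine class restricts to a class locally trivial at every prime** on `kerStab κ θ = Gal(K̄/K_∞(θ))`.
[cite: CoatesSujatha2005, §3] [cite: SerreGaloisCohomology1997, I.§2.5] -/
theorem forall_prime_resOfLe_of_mem_fineSelmerInfty {η : W.subgroupH1 p κ.kerSubgroup} (hη : η ∈ W.fineSelmerInfty κ)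
    (𝔓 : Ideal (absIntegers (𝓞 K) K)) [𝔓.IsMaximal] :
    W.resOfLe p (inf_le_left : kerStab κ θ ⊓ 𝔓.decompositionSubgroup (absoluteGaloisGroup K) ≤ kerStab κ θ)
      (W.resOfLe p (kerStab_le κ θ) η) = 0 :=
  forall_prime_resOfLe (kerStab κ θ) (kerStab_le κ θ) η (fun 𝔓' _ ↦ forall_prime_of_mem_fineSelmerInfty κ hη 𝔓') 𝔓

/-- **The twisted restriction `Ψ(res η′)` of a fine class of `E₂` is locally trivial at every prime.**
[cite: GreenbergLNM1716, §4 p. 107] [cite: CoatesSujatha2005, §3] -/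
theorem forall_prime_twistResEquiv_resOfLe_of_mem_fineSelmerInfty {η' : W₂.subgroupH1 p κ.kerSubgroup}
    (hη' : η' ∈ W₂.fineSelmerInfty κ) (𝔓 : Ideal (absIntegers (𝓞 K) K)) [𝔓.IsMaximal] :
    W.resOfLe p (inf_le_left : kerStab κ θ ⊓ 𝔓.decompositionSubgroup (absoluteGaloisGroup K) ≤ kerStab κ θ)
      (twistResEquiv W W₂ hd hV hθ κ (W₂.resOfLe p (kerStab_le κ θ) η')) = 0 :=
  (resOfLe_twistResEquiv_eq_zero_iff κ W W₂ hd hV hθ _ _).2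
    (forall_prime_resOfLe_of_mem_fineSelmerInfty κ W₂ hη' 𝔓)

include hd hcκ hcθ in
/-- **THE FINE `±`-DECOMPOSITION OVER `K_∞` (both bounds).** With `Φ(η, η′) = res η + Ψ(res η′)` on
`Sel₀(K_∞, E[p^∞]) × Sel₀(K_∞, E₂[p^∞])` (`E₂` a `K`-model of `E^{(d)}`, `θ² = d`, `c ∈ Gal(K̄/K_∞)` with `c θ = −θ`):
(1) `Φ(η, η′) = 0 ⟹ 4η = 0 ∧ 4η′ = 0`; (2) every class `ζ ∈ H¹(Gal(K̄/K_∞(θ)), E[p^∞])` locally trivial at every prime has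
`4ζ = Φ(η, η′)` for fine `η`, `η′`.  The engine `IndexTwoDecompositionData` of `H1CorestrictionIndexTwo` with
`T` = {classes locally trivial at every prime}: `res`/`Ψ res` land in `T` (§1, §3), `T` is `conj_c`-stable (§1), and
`res η ∈ T ⟹ 2η ∈ Sel₀` (§2). [cite: DokchitserDokchitserAnnals2010, Lemma 4.14 (proof)] [cite: GreenbergLNM1716, §4 p. 107] -/
theorem four_nsmul_eq_zero_and_exists_eq_four_nsmul [(kerStab κ θ).Normal] :
    (∀ (η : W.subgroupH1 p κ.kerSubgroup) (_ : η ∈ W.fineSelmerInfty κ) (η' : W₂.subgroupH1 p κ.kerSubgroup)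
        (_ : η' ∈ W₂.fineSelmerInfty κ),
        W.resOfLe p (kerStab_le κ θ) η + twistResEquiv W W₂ hd hV hθ κ (W₂.resOfLe p (kerStab_le κ θ) η') = 0 →
          4 • η = 0 ∧ 4 • η' = 0) ∧
    ∀ ζ : W.subgroupH1 p (kerStab κ θ),
      (∀ (𝔓 : Ideal (absIntegers (𝓞 K) K)), 𝔓.IsMaximal →
        W.resOfLe p (inf_le_left : kerStab κ θ ⊓ 𝔓.decompositionSubgroup (absoluteGaloisGroup K) ≤ kerStab κ θ) ζ = 0) →
      ∃ (η : W.subgroupH1 p κ.kerSubgroup) (_ : η ∈ W.fineSelmerInfty κ) (η' : W₂.subgroupH1 p κ.kerSubgroup)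
        (_ : η' ∈ W₂.fineSelmerInfty κ),
        W.resOfLe p (kerStab_le κ θ) η + twistResEquiv W W₂ hd hV hθ κ (W₂.resOfLe p (kerStab_le κ θ) η') = 4 • ζ := by
  haveI := finiteIndex_kerStab_subgroupOf κ hd hθ hcκ hcθ
  have hidx : (kerStab κ θ).relIndex κ.kerSubgroup ∣ 2 := by rw [relIndex_kerStab κ hd hθ hcκ hcθ]
  -- the target: classes on `kerStab κ θ` locally trivial at every prime
  let LT : AddSubgroup (W.subgroupH1 p (kerStab κ θ)) :=
    ⨅ (𝔓 : Ideal (absIntegers (𝓞 K) K)) (_ : 𝔓.IsMaximal),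
      (W.resOfLe p (inf_le_left : kerStab κ θ ⊓ 𝔓.decompositionSubgroup (absoluteGaloisGroup K) ≤ kerStab κ θ)).ker
  have hLT : ∀ y, y ∈ LT ↔ ∀ (𝔓 : Ideal (absIntegers (𝓞 K) K)), 𝔓.IsMaximal →
      W.resOfLe p (inf_le_left : kerStab κ θ ⊓ 𝔓.decompositionSubgroup (absoluteGaloisGroup K) ≤ kerStab κ θ) y = 0 := by
    intro y
    simp only [LT, AddSubgroup.mem_iInf, AddMonoidHom.mem_ker]
  -- the engine
  let D : IndexTwoDecompositionData ((kerStab κ θ).subgroupOf κ.kerSubgroup) (⟨c, hcκ⟩ : κ.kerSubgroup)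
      (geomPrimaryTorsion W p) (geomPrimaryTorsion W₂ p) :=
    { isOpen := isOpen_kerStab_subgroupOf κ θ
      xor := xor_kerStab κ hd hθ hcκ hcθ
      continuous_smul := fun m ↦ (continuous_smul_geomPrimaryTorsion W p m).comp continuous_subtype_val
      continuous_smul' := fun m ↦ (continuous_smul_geomPrimaryTorsion W₂ p m).comp continuous_subtype_val
      ψ := twistPrimaryEquiv W W₂ hd hV hθ p
      hψ := twistPrimaryEquiv_smul_subgroupOf κ W W₂ hd hV hθ
      hψc := twistPrimaryEquiv_smul_neg κ W W₂ hd hV hθ hcκ hcθ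
      S := W.fineSelmerInfty κ
      S' := W₂.fineSelmerInfty κ
      T := LT.map (toSubgroupOfH1 (kerStab κ θ) κ.kerSubgroup (geomPrimaryTorsion W p))
      res_mem := fun η hη ↦ by
        refine ⟨W.resOfLe p (kerStab_le κ θ) η, (hLT _).2 fun 𝔓 h𝔓 ↦ ?_, ?_⟩
        · exact forall_prime_resOfLe_of_mem_fineSelmerInfty κ W hη 𝔓
        · rw [resSubgroupH1_subgroupOf_eq _ (kerStab_le κ θ)]
      res_mem' := fun η' hη' ↦ by
        refine ⟨twistResEquiv W W₂ hd hV hθ κ (W₂.resOfLe p (kerStab_le κ θ) η'), (hLT _).2 fun 𝔓 h𝔓 ↦ ?_, ?_⟩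
        · exact forall_prime_twistResEquiv_resOfLe_of_mem_fineSelmerInfty κ W W₂ hd hV hθ hη' 𝔓
        · rw [h1Equiv_resSubgroupH1_eq]
      conj_mem := by
        rintro _ ⟨y, hy, rfl⟩
        refine ⟨W.conjH1 p (kerStab κ θ) c y, (hLT _).2 fun 𝔓 h𝔓 ↦ ?_, ?_⟩
        · exact forall_prime_conjH1 (kerStab κ θ) y ((hLT y).1 hy) c 𝔓
        · rw [conjH1_toSubgroupOfH1]
      a := 1
      mem_of_res_mem := by
        rintro η ⟨y, hy, hyη⟩
        rw [resSubgroupH1_subgroupOf_eq _ (kerStab_le κ θ)] at hyη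
        have hinj : y = W.resOfLe p (kerStab_le κ θ) η := by
          have h := congrArg (ofSubgroupOfH1 (geomPrimaryTorsion W p) (kerStab_le κ θ)) hyη
          rwa [ofSubgroupOfH1_toSubgroupOfH1, ofSubgroupOfH1_toSubgroupOfH1] at h
        rw [hinj] at hy
        rw [pow_one]
        exact two_nsmul_mem_fineSelmerInfty_of_forall_prime κ (kerStab_le κ θ) η ((hLT _).1 hy)
          (isOpen_kerStab_subgroupOf κ θ) hidx
      mem_of_res_mem' := by
        rintro η' ⟨y, hy, hyη⟩
        rw [h1Equiv_resSubgroupH1_eq] at hyη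
        have hinj : y = twistResEquiv W W₂ hd hV hθ κ (W₂.resOfLe p (kerStab_le κ θ) η') := by
          have h := congrArg (ofSubgroupOfH1 (geomPrimaryTorsion W p) (kerStab_le κ θ)) hyη
          rwa [ofSubgroupOfH1_toSubgroupOfH1, ofSubgroupOfH1_toSubgroupOfH1] at h
        rw [hinj] at hy
        rw [pow_one]
        exact two_nsmul_mem_fineSelmerInfty_of_forall_prime κ (kerStab_le κ θ) η'
          ((forall_prime_twistResEquiv_iff κ W W₂ hd hV hθ _).1 ((hLT _).1 hy)) (isOpen_kerStab_subgroupOf κ θ) hidx }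
  refine ⟨fun η hη η' hη' h0 ↦ ?_, fun ζ hζ ↦ ?_⟩
  · -- (1) the kernel is killed by `4`
    have hD : D.decompMap (⟨η, hη⟩, ⟨η', hη'⟩) = 0 := by
      apply Subtype.ext
      rw [IndexTwoDecompositionData.coe_decompMap_apply, ZeroMemClass.coe_zero]
      change resSubgroupH1 _ _ η +
        h1Equiv (twistPrimaryEquiv W W₂ hd hV hθ p) (twistPrimaryEquiv_smul_subgroupOf κ W W₂ hd hV hθ)
          (resSubgroupH1 _ _ η') = 0
      rw [resSubgroupH1_subgroupOf_eq _ (kerStab_le κ θ), h1Equiv_resSubgroupH1_eq, ← map_add]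
      change toSubgroupOfH1 (kerStab κ θ) κ.kerSubgroup (geomPrimaryTorsion W p)
        (W.resOfLe p (kerStab_le κ θ) η + twistResEquiv W W₂ hd hV hθ κ (W₂.resOfLe p (kerStab_le κ θ) η')) = 0
      rw [h0, map_zero]
    have h4 := D.nsmul_eq_zero_of_decompMap_eq_zero _ hD
    simp only [Prod.smul_mk, Prod.mk_eq_zero] at h4
    obtain ⟨h4a, h4b⟩ := h4
    exact ⟨by simpa using congrArg Subtype.val h4a, by simpa using congrArg Subtype.val h4b⟩
  · -- (2) `4 · T` lies in the image
    have hζT : toSubgroupOfH1 (kerStab κ θ) κ.kerSubgroup (geomPrimaryTorsion W p) ζ ∈ D.T := ⟨ζ, (hLT ζ).2 hζ, rfl⟩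
    obtain ⟨⟨⟨η, hη⟩, ⟨η', hη'⟩⟩, hx⟩ := D.pow_nsmul_mem_range_decompMap ⟨_, hζT⟩
    refine ⟨η, hη, η', hη', ?_⟩
    have h := congrArg Subtype.val hx
    rw [IndexTwoDecompositionData.coe_decompMap_apply] at h
    change resSubgroupH1 _ _ η +
        h1Equiv (twistPrimaryEquiv W W₂ hd hV hθ p) (twistPrimaryEquiv_smul_subgroupOf κ W W₂ hd hV hθ)
          (resSubgroupH1 _ _ η') =
      2 ^ (1 + 1) • toSubgroupOfH1 (kerStab κ θ) κ.kerSubgroup (geomPrimaryTorsion W p) ζ at h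
    rw [resSubgroupH1_subgroupOf_eq _ (kerStab_le κ θ), h1Equiv_resSubgroupH1_eq, ← map_add, ← map_nsmul] at h
    have h' := congrArg (ofSubgroupOfH1 (geomPrimaryTorsion W p) (kerStab_le κ θ)) h
    rw [ofSubgroupOfH1_toSubgroupOfH1, ofSubgroupOfH1_toSubgroupOfH1] at h'
    rw [show (4 : ℕ) = 2 ^ (1 + 1) by norm_num]
    exact h'

include hd hcκ hcθ in
/-- **The kernel of `(η, η′) ↦ res η + Ψ(res η′)` on the fine Selmer groups is killed by `4`.**
[cite: DokchitserDokchitserAnnals2010, Lemma 4.14 (proof)] -/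
theorem four_nsmul_eq_zero_of_fineRes_add_twistFineRes_eq_zero [(kerStab κ θ).Normal]
    {η : W.subgroupH1 p κ.kerSubgroup} (hη : η ∈ W.fineSelmerInfty κ)
    {η' : W₂.subgroupH1 p κ.kerSubgroup} (hη' : η' ∈ W₂.fineSelmerInfty κ)
    (h0 : W.resOfLe p (kerStab_le κ θ) η + twistResEquiv W W₂ hd hV hθ κ (W₂.resOfLe p (kerStab_le κ θ) η') = 0) :
    4 • η = 0 ∧ 4 • η' = 0 :=
  (four_nsmul_eq_zero_and_exists_eq_four_nsmul κ W W₂ hd hV hθ hcκ hcθ).1 η hη η' hη' h0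

include hd hcκ hcθ in
/-- **`4 ζ = res η + Ψ(res η′)` with fine `η`, `η′`, for every class `ζ` on `Gal(K̄/K_∞(θ))` locally trivial at every prime.**
[cite: DokchitserDokchitserAnnals2010, Lemma 4.14 (proof)] -/
theorem exists_fineRes_add_twistFineRes_eq_four_nsmul [(kerStab κ θ).Normal] (ζ : W.subgroupH1 p (kerStab κ θ))
    (hζ : ∀ (𝔓 : Ideal (absIntegers (𝓞 K) K)), 𝔓.IsMaximal →
      W.resOfLe p (inf_le_left : kerStab κ θ ⊓ 𝔓.decompositionSubgroup (absoluteGaloisGroup K) ≤ kerStab κ θ) ζ = 0) :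
    ∃ (η : W.subgroupH1 p κ.kerSubgroup) (_ : η ∈ W.fineSelmerInfty κ) (η' : W₂.subgroupH1 p κ.kerSubgroup)
      (_ : η' ∈ W₂.fineSelmerInfty κ),
      W.resOfLe p (kerStab_le κ θ) η + twistResEquiv W W₂ hd hV hθ κ (W₂.resOfLe p (kerStab_le κ θ) η') = 4 • ζ :=
  (four_nsmul_eq_zero_and_exists_eq_four_nsmul κ W W₂ hd hV hθ hcκ hcθ).2 ζ hζ

end Data

end FineQuadraticLayer

end Literature.NumberTheory.EllipticCurves

end
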